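import Literature.AlgebraicGeometry.Motives.AbelianVarietyQuotientFree
import Literature.AlgebraicGeometry.Motives.AbelianVarietyKummerBound
import HarnessLib

/-!
# Translations of an abelian variety by non-trivial rational points act freely on affine opens

Layer `Literature/AlgebraicGeometry/Motives`, namespace `Literature.AlgebraicGeometry.Motives.AbelianVariety`.
(Typing debt of cell `pub-hodge-ring2`, R13.62 (2), in support of `IsogenyPullbackPushforwardDecomposition`:
research route conditional on HC_CM; not a corollary; Q11.4-sentence-2 already refuted in dim ≥ 3.)

For an abelian variety `A` over a field `K` and a rational point `Q ∈ A(K)`: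

* `span_range_translation_appLE_sub_eq_top` — **freeness on affine charts** (the scheme-theoretic freeness hypothesis of
  Chase–Harrison–Rosenberg, cf. the tree's `quotAction_free` for `A_L`): for `Q ≠ 1` and an affine open `U ⊆ A` with
  `U ⊆ t_Q⁻¹ U`, the elements `t_Q♯ b - b`, `b ∈ Γ(A, U)`, generate the unit ideal of `Γ(A, U)` — otherwise a maximal ideal
  `𝔪` above them gives the `Γ(A, U)/𝔪`-valued point `Spec (Γ/𝔪) → Spec Γ(A, U) ≅ U ⊆ A` fixed by `t_Q`, and a non-trivial
  translation has no such fixed point (the tree's `eq_one_of_comp_translation_left_eq`, `AbelianVarietyKummerBound`). Mumford, *Abelian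
  Varieties* §7 Thm. 4 (p. 72) (a finite subgroup acts freely; the quotient is an isogeny) with Greither, LNM 1534, Ch. 0
  Thm. 1.6 (i) (freeness as "the `σ b - b` generate the unit ideal").

## References

* [GortzWedhorn2023] U. Görtz, T. Wedhorn, *Algebraic Geometry II* (2023), Def./Rem. 27.1 (p. 799).
* [MumfordAV1970] D. Mumford, *Abelian Varieties* (1970), §7 Thm. 4 (p. 72).
* [Greither1992CyclicGalois] C. Greither, *Cyclic Galois extensions of commutative rings*, LNM 1534 (1992), Ch. 0 Thm. 1.6.
-/

noncomputable section

universe u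

open CategoryTheory CategoryTheory.Limits AlgebraicGeometry

namespace Literature.AlgebraicGeometry.Motives

namespace AbelianVariety

open scoped MonObj Obj

variable {K : Type u} [Field K] (A : AbelianVariety K)

/-- **Translations by `Q ≠ 1` act freely on affine charts**: for an affine open `U ⊆ A` with `U ⊆ t_Q⁻¹U`, the elements
`t_Q♯ b - b` (`b ∈ Γ(A, U)`) generate the unit ideal of `Γ(A, U)`. [cite: MumfordAV1970, §7 Thm. 4 (p. 72)]
[cite: Greither1992CyclicGalois, Ch. 0 Thm. 1.6 (i) (pp. 3–4)] -/
theorem span_range_translation_appLE_sub_eq_top {U : A.X.left.Opens} (hU : IsAffineOpen U) (Q : A.Points K)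
    (hQ : Q ≠ 1) (hle : U ≤ (A.translation Q).left ⁻¹ᵁ U) :
    Ideal.span (Set.range fun b : Γ(A.X.left, U) => (A.translation Q).left.appLE U U hle b - b) = ⊤ := by
  by_contra hne
  obtain ⟨𝔪, h𝔪, hle𝔪⟩ := Ideal.exists_le_maximal _ hne
  let ψ : Γ(A.X.left, U) →+* Γ(A.X.left, U) ⧸ 𝔪 := Ideal.Quotient.mk 𝔪
  have hψ : ψ.comp ((A.translation Q).left.appLE U U hle).hom = ψ := by
    ext b
    exact Ideal.Quotient.eq.mpr (hle𝔪 (Ideal.subset_span ⟨b, rfl⟩))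
  haveI : Nontrivial (Γ(A.X.left, U) ⧸ 𝔪) := Ideal.Quotient.nontrivial_iff.mpr h𝔪.ne_top
  -- the `Γ/𝔪`-valued point of `U ⊆ A`
  let x : Spec (.of (Γ(A.X.left, U) ⧸ 𝔪)) ⟶ A.X.left := Spec.map (CommRingCat.ofHom ψ) ≫ hU.fromSpec
  -- it is fixed by `t_Q`
  have hx : x ≫ (A.translation Q).left = x := by
    have h1 : (A.translation Q).left.appLE U U hle ≫ CommRingCat.ofHom ψ = CommRingCat.ofHom ψ :=
      CommRingCat.hom_ext hψ
    change (Spec.map (CommRingCat.ofHom ψ) ≫ hU.fromSpec) ≫ (A.translation Q).left =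
      Spec.map (CommRingCat.ofHom ψ) ≫ hU.fromSpec
    rw [Category.assoc, ← IsAffineOpen.SpecMap_appLE_fromSpec (A.translation Q).left hU hU hle,
      ← Spec.map_comp_assoc, h1]
  -- hence `Q = 1`
  haveI : Epi (x ≫ A.X.hom) := epi_of_hom_spec_field _
  exact hQ (A.eq_one_of_comp_translation_left_eq x Q hx)

end AbelianVariety

end Literature.AlgebraicGeometry.Motives

end
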